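import Literature.NumberTheory.PAdicHodge.TatePairingCochainFilOne
import Literature.NumberTheory.PAdicHodge.WeilPeriodForm
import Literature.NumberTheory.PAdicHodge.NeronDeRhamDatum
import Literature.NumberTheory.PAdicHodge.LegendreOfPeriodHoms
import HarnessLib

/-!
# The `ω`-PERIOD HOMOMORPHISM of a line datum: `Pω(S) = ⟨S, ω_d⟩~ ∈ Fil¹ B_dR⁺(F)`, equivariant, `ℤ_p`-linear, non-zero

Topic `Literature/NumberTheory/PAdicHodge`; namespace `Literature.NumberTheory.PAdicHodge`. THEOREMS ONLY (no definition, no named fact, no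
instance, no `sorry`). For an elliptic curve `W/K₀ ⊆ F` (`F` a `p`-adic field with its canonical `ℚ_p`-structure `halg`), its Weil tower `e_∞` on
`T_pW|_{Γ_F}` (alternating and non-degenerate) and a LINE DATUM `d` of `V_pW|_{Γ_F}` for `B_dR(F)` (`PeriodRingData.FilZeroLine`: a nonzero
`Γ_F`-invariant `ω_d ∈ Fil⁰(B_dR ⊗ V_pW) = B_dR⁺ ⊗ V_pW`), the extended Weil pairing `⟨·,·⟩~ : T_pW × (B_dR ⊗ V_pW) → B_dR`
(`weilPeriodPairing`, `⟨S, b ⊗ (c ⊗ T)⟩~ = b·c·ι(e_∞(S,T))`) produces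

★★ `exists_periodHom_of_filZeroLine` — **an additive `Pω : T_pW → B_dR⁺(F)` with `j(Pω(S)) = ⟨S, ω_d⟩~`**, which is `ℤ_p`-LINEAR
(`weilPeriodPairing_smul_left`), `Γ_F`-EQUIVARIANT (`smul_weilPeriodPairing` + `ω_d ∈ D(V)`), `Fil¹`-VALUED (`ω_d ∈ Fil⁰B ⊗ V`, `ι(ζ) ∈ Fil¹`:
`weilPeriodPairing_mem_fil_one`, `Fil¹B_dR = j(ξ B_dR⁺)`) and NON-ZERO (expanding `ω_d = r₀ ⊗ v₀ + r₁ ⊗ v₁` on a `ℤ_p`-basis: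
`⟨b₀, ω_d⟩~ = r₁·ι(e_∞(b₀,b₁))`, `⟨b₁, ω_d⟩~ = r₀·ι(e_∞(b₁,b₀))`, and `ι(e_∞(b₀,b₁)) ≠ 0` by non-degeneracy).

These are EXACTLY the hypotheses `hPωZ`, `hPω`, `hfil`, `hne` on `Pω` of the socket `TatePairingPointOfKTwoBasis.exists_const_tatePairingPoint_eq_neg_trace_of_KTwoBasis`
— so the `ω`-period map of the socket can always be taken from the de Rham line datum, with NO geometric construction (memo
`Summits/BirchSwinnertonDyer/BirchSwinnertonDyer/Cruxes/StarredOptimalManinUnitFiveSeven/Lines/kato-lever-seam-rec-at-cells.md` §17, brick B6 of the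
ORDINARY = unit-root frame, where no matching `T_pE ≃ T_pŴ` transports the formal `∫ω` to all of `T_pE`). BSD / K★ (`stmt-BirchSwinnertonDyer-22226`)
are NOT proved by any of this.

## References
* K. Kato, LNM 1553 (1993), Ch. II §1.2.4, Ex. 1.3.5, proof of Lemma 1.4.3. [Kato1993LNM1553]
* J.-M. Fontaine, Astérisque 223 (1994), Exp. II §1.5.5, Exp. III §1.5. [FontaineAsterisque223III]
* J. Tate, *p-divisible groups* (1967), §4 (the Weil pairing on Tate modules). [Tate1967]
-/

noncomputable section

open Field Function ValuativeRel WittVector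
open scoped TensorProduct

namespace Literature.NumberTheory.PAdicHodge

open Literature.NumberTheory.GaloisRepresentations
open Literature.NumberTheory.GaloisRepresentations.IsNonarchimedeanLocalField
open Literature.NumberTheory.GaloisCohomology
open Literature.NumberTheory.EllipticCurves
open _root_.WeierstrassCurve

variable {F : Type} [Field F] [ValuativeRel F] [TopologicalSpace F] [IsNonarchimedeanLocalField F] [CharZero F]
  {p : ℕ} [Fact p.Prime] [Fact (¬ IsUnit (p : integerC F))] [IsAdicComplete (Ideal.span {(p : integerC F)}) (integerC F)]
  [Algebra ℚ_[p] F] {K₀ : Type} [Field K₀] [CharZero K₀] (W : WeierstrassCurve K₀) [Algebra K₀ F] [W.IsElliptic]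
  (e : (k : ℕ) → geomTorsion W ((p ^ k : ℕ) : ℤ) → geomTorsion W ((p ^ k : ℕ) : ℤ) → AlgebraicClosure K₀)
  (hμ : ∀ k S T, e k S T ^ (p ^ k) = 1) (hadd₁ : ∀ k S₁ S₂ T, e k (S₁ + S₂) T = e k S₁ T * e k S₂ T)
  (hadd₂ : ∀ k S T₁ T₂, e k S (T₁ + T₂) = e k S T₁ * e k S T₂)
  (hgal : ∀ k (σ : absoluteGaloisGroup K₀) (S T : geomTorsion W ((p ^ k : ℕ) : ℤ)), σ • e k S T = e k (σ • S) (σ • T))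
  (hcompat : ∀ k (S T : geomTorsion W ((p ^ (k + 1) : ℕ) : ℤ)),
    e k (torsionMulHom W (p ^ (k + 1)) (p ^ k) p (pow_succ p k).symm S)
      (torsionMulHom W (p ^ (k + 1)) (p ^ k) p (pow_succ p k).symm T) = e (k + 1) S T ^ p)
  (hp : valuation F p < 1) (halg : ∀ c : ℚ_[p], algebraMap ℚ_[p] F c = LocalField.padicRingHom F p hp c)

/-! ## §1 Non-degeneracy of `⟨·,·⟩~` against `T_pW` -/

include hgal halg in
set_option maxHeartbeats 1600000 in
/-- ★ **`⟨S, y⟩~ = 0` for all `S ∈ T_pW` forces `y = 0`** (`y ∈ B_dR ⊗ V_pW`), when `e_∞` is alternating and non-degenerate: on a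
`ℤ_p`-basis `(b₀, b₁)`, `y = r₀ ⊗ b₀ + r₁ ⊗ b₁`, `⟨b₀, y⟩~ = r₁·ι(e_∞(b₀,b₁))`, `⟨b₁, y⟩~ = r₀·ι(e_∞(b₁,b₀))`, and `ι(e_∞(bᵢ,bⱼ)) ≠ 0` (`ι`
injective, `B_dR` a field). [cite: Kato1993LNM1553, Ch. II, proof of Lemma 1.4.3] [cite: Tate1967, §4] -/
theorem eq_zero_of_forall_weilPeriodPairing_eq_zero
    (healt : ∀ S : W.tateModule p, (weilContPairingPadic W F p e hμ hadd₁ hadd₂ hgal hcompat).toLin S S = 0)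
    (henondeg : ∀ S : W.tateModule p, (∀ U, (weilContPairingPadic W F p e hμ hadd₁ hadd₂ hgal hcompat).toLin S U = 0) → S = 0)
    {y : (bdRPeriodRingData (F := F) (p := p) hp).B ⊗[ℚ_[p]] W.rationalTateModule p}
    (hy : ∀ S : W.tateModule p,
      weilPeriodPairing W (bdRPeriodRingData hp) (bdRPlusToFrac hp) e hμ hadd₁ hadd₂ hcompat (bdRPlusToFrac_qpToBdR hp halg) S y = 0) :
    y = 0 := by
  classical
  have hpK : (p : K₀) ≠ 0 := Nat.cast_ne_zero.mpr (Fact.out : p.Prime).ne_zero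
  haveI := module_free_tateModule_holds W p
  haveI := module_finite_tateModule_holds W p
  let b : Module.Basis (Fin 2) ℤ_[p] (W.tateModule p) := Module.finBasisOfFinrankEq ℤ_[p] _ (finrank_tateModule_eq_two_holds W p hpK)
  let v : Module.Basis (Fin 2) ℚ_[p] (W.rationalTateModule p) := Algebra.TensorProduct.basis ℚ_[p] b
  have hv : ∀ i, v i = TateModule.toRational p (b i) := fun i => by
    rw [TateModule.toRational_apply]; exact Algebra.TensorProduct.basis_apply b i
  let vB : Module.Basis (Fin 2) (bdRPeriodRingData (F := F) (p := p) hp).B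
      ((bdRPeriodRingData (F := F) (p := p) hp).B ⊗[ℚ_[p]] W.rationalTateModule p) :=
    Algebra.TensorProduct.basis _ v
  set E := weilContPairingPadic W F p e hμ hadd₁ hadd₂ hgal hcompat with hE
  -- `⟨S, y⟩~ = Σ rᵢ · ι(e_∞(S, bᵢ))`
  have hexp : ∀ S : W.tateModule p,
      weilPeriodPairing W (bdRPeriodRingData hp) (bdRPlusToFrac hp) e hμ hadd₁ hadd₂ hcompat (bdRPlusToFrac_qpToBdR hp halg) S y =
        vB.repr y 0 * periodLineFrac hp (E.toLin S (b 0)) + vB.repr y 1 * periodLineFrac hp (E.toLin S (b 1)) := by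
    intro S
    have hterm : ∀ i, weilPeriodPairing W (bdRPeriodRingData hp) (bdRPlusToFrac hp) e hμ hadd₁ hadd₂ hcompat (bdRPlusToFrac_qpToBdR hp halg) S
        (vB.repr y i • vB i) = vB.repr y i * periodLineFrac hp (E.toLin S (b i)) := by
      intro i
      rw [Algebra.TensorProduct.basis_apply, TensorProduct.smul_tmul', smul_eq_mul, mul_one, weilPeriodPairing_tmul_eq_mul, hv,
        ← toAmbient_apply, weilPeriodPairing_toAmbient]
    conv_lhs => rw [← vB.sum_repr y]
    rw [map_sum, Fin.sum_univ_two, hterm, hterm]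
  -- `e_∞(b₀, b₁) ≠ 0 ≠ e_∞(b₁, b₀)` (non-degeneracy + alternation on the basis)
  have heR : ∀ (c : ℤ_[p]) (S U : W.tateModule p), E.toLin S (c • U) = twistHom F p (E.toLin S U) c := fun c S U => by
    rw [hE, weilContPairingPadic_toLin_apply, weilContPairingPadic_toLin_apply]
    exact weilPairingPadicHom_smul_right W e hμ hadd₁ hadd₂ hcompat S U c
  have htw0 : ∀ a : ℤ_[p], twistHom F p (0 : (muPadicSystem F p).limit) a = 0 := fun a => by
    rw [← map_zero (epsLineEquiv F p), epsLineEquiv_apply, twistHom_twistHom, zero_mul]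
  have hU : ∀ U : W.tateModule p, U = b.repr U 0 • b 0 + b.repr U 1 • b 1 := fun U => by
    conv_lhs => rw [← b.sum_repr U]
    rw [Fin.sum_univ_two]
  have hne01 : periodLineFrac hp (E.toLin (b 0) (b 1)) ≠ 0 := by
    intro h0
    have he01 : E.toLin (b 0) (b 1) = 0 := periodLineFrac_injective hp (by rw [h0, map_zero])
    refine b.ne_zero 0 (henondeg (b 0) fun U => ?_)
    rw [hU U, map_add, heR, heR, healt, he01, htw0, htw0, add_zero]
  have hne10 : periodLineFrac hp (E.toLin (b 1) (b 0)) ≠ 0 := by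
    intro h0
    have he10 : E.toLin (b 1) (b 0) = 0 := periodLineFrac_injective hp (by rw [h0, map_zero])
    refine b.ne_zero 1 (henondeg (b 1) fun U => ?_)
    rw [hU U, map_add, heR, heR, he10, healt, htw0, htw0, add_zero]
  have h0 := hy (b 0)
  have h1 := hy (b 1)
  rw [hexp, healt, (periodLineFrac hp).map_zero, mul_zero, zero_add] at h0
  rw [hexp, healt, (periodLineFrac hp).map_zero, mul_zero, add_zero] at h1
  have hr1 : vB.repr y 1 = 0 := (mul_eq_zero.1 h0).resolve_right hne01
  have hr0 : vB.repr y 0 = 0 := (mul_eq_zero.1 h1).resolve_right hne10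
  rw [← vB.sum_repr y, Fin.sum_univ_two, hr0, hr1, zero_smul, zero_smul, add_zero]

/-! ## §2 The `ω`-period homomorphism of a line datum -/

include hgal halg in
set_option maxHeartbeats 1600000 in
/-- ★★ **The `ω`-period homomorphism of a line datum.** For a line datum `d` of `V_pW|_{Γ_F}` (nonzero invariant `ω_d ∈ B_dR⁺ ⊗ V_pW`) and an
alternating non-degenerate Weil tower there is an additive `Pω : T_pW → B_dR⁺(F)` with **`j(Pω S) = ⟨S, ω_d⟩~`** which is `ℤ_p`-linear,
`Γ_F`-equivariant, `Fil¹`-valued and non-zero — the hypotheses `hPωZ`, `hPω`, `hfil`, `hne` of `TatePairingPointOfKTwoBasis`.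
[cite: Kato1993LNM1553, Ch. II §1.2.4, Ex. 1.3.5 and proof of Lemma 1.4.3] [cite: FontaineAsterisque223III, Exp. II §1.5.5] -/
theorem exists_periodHom_of_filZeroLine
    (healt : ∀ S : W.tateModule p, (weilContPairingPadic W F p e hμ hadd₁ hadd₂ hgal hcompat).toLin S S = 0)
    (henondeg : ∀ S : W.tateModule p, (∀ U, (weilContPairingPadic W F p e hμ hadd₁ hadd₂ hgal hcompat).toLin S U = 0) → S = 0)
    (d : (bdRPeriodRingData (F := F) (p := p) hp).FilZeroLine (restrictedRationalTateRep W F p)) :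
    ∃ Pω : W.tateModule p →+ BdRPlusTop F p,
      (∀ (c : ℤ_[p]) (a : W.tateModule p), Pω (c • a) = BdRPlusTop.of F p (qpToBdR (c : ℚ_[p])) * Pω a) ∧
      (∀ (σ : absoluteGaloisGroup F) (a : W.tateModule p), BdRPlusTop.gal F p σ (Pω a) = Pω (restrictedTateRep W F p σ a)) ∧
      (∀ a, Pω a ∈ (BdRPlusTop.filOne F p).toIdeal) ∧ (∃ a, Pω a ≠ 0) ∧
      ∀ a, bdRPlusToFrac hp ((BdRPlusTop.of F p).symm (Pω a)) =
        weilPeriodPairing W (bdRPeriodRingData hp) (bdRPlusToFrac hp) e hμ hadd₁ hadd₂ hcompat (bdRPlusToFrac_qpToBdR hp halg) a d.ω := by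
  set P := weilPeriodPairing W (bdRPeriodRingData hp) (bdRPlusToFrac hp) e hμ hadd₁ hadd₂ hcompat (bdRPlusToFrac_qpToBdR hp halg) with hP
  -- the values `⟨S, ω_d⟩~ ∈ Fil¹ B_dR = j(ξ B_dR⁺)`
  have hmem : ∀ S, P S d.ω ∈ (bdRPeriodRingData (F := F) (p := p) hp).fil 1 := fun S =>
    weilPeriodPairing_mem_fil_one (bdRPeriodRingData hp) (bdRPlusToFrac hp) W e hμ hadd₁ hadd₂ hcompat (bdRPlusToFrac_qpToBdR hp halg)
      (bdRPlusToFrac_tBdR_mem_fil_one hp) S d.mem_filTensor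
  choose b hb hbP using fun S => exists_mem_span_xiBdR_of_mem_fil_one hp (hmem S)
  have hinj := bdRPlusToFrac_injective (F := F) (p := p) hp
  have hadd : ∀ S S', b (S + S') = b S + b S' := fun S S' =>
    hinj (by rw [map_add, hbP, hbP, hbP, map_add, AddMonoidHom.add_apply])
  refine ⟨AddMonoidHom.mk' (fun S => BdRPlusTop.of F p (b S)) (fun S S' => by rw [hadd, map_add]), ?_, ?_, ?_, ?_, ?_⟩
  · -- `ℤ_p`-linearity
    intro c a
    change BdRPlusTop.of F p (b (c • a)) = BdRPlusTop.of F p (qpToBdR (c : ℚ_[p])) * BdRPlusTop.of F p (b a)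
    rw [← map_mul]
    congr 1
    refine hinj ?_
    rw [hbP, map_mul, hbP, bdRPlusToFrac_qpToBdR hp halg, hP, weilPeriodPairing_smul_left]
  · -- equivariance
    intro σ a
    change BdRPlusTop.gal F p σ (BdRPlusTop.of F p (b a)) = BdRPlusTop.of F p (b (restrictedTateRep W F p σ a))
    rw [BdRPlusTop.gal_of]
    congr 1
    refine hinj ?_
    rw [bdRPlusToFrac_galBdRPlus, hbP, hbP, hP,
      smul_weilPeriodPairing W (bdRPeriodRingData hp) (bdRPlusToFrac hp) e hμ hadd₁ hadd₂ hgal hcompat (bdRPlusToFrac_qpToBdR hp halg)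
        (bdRPlusToFrac_galBdRPlus hp),
      ((bdRPeriodRingData (F := F) (p := p) hp).mem_D_iff _ _).1 d.mem_D σ]
  · -- `Fil¹`
    intro a
    refine BdRPlusTop.mem_filOne_iff.2 ?_
    change (BdRPlusTop.of F p).symm (BdRPlusTop.of F p (b a)) ∈ _
    rw [RingEquiv.symm_apply_apply]
    exact hb a
  · -- non-zero
    by_contra hzero
    have hzero' : ∀ a, b a = 0 := fun a => by
      have h := not_exists.1 hzero a
      rw [not_not] at h
      exact (BdRPlusTop.of F p).injective (by rw [map_zero]; exact h)
    have hy : ∀ S, P S d.ω = 0 := fun S => by rw [← hbP, hzero', map_zero]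
    exact d.ne_zero (eq_zero_of_forall_weilPeriodPairing_eq_zero W e hμ hadd₁ hadd₂ hgal hcompat hp halg healt henondeg hy)
  · intro a
    change bdRPlusToFrac hp ((BdRPlusTop.of F p).symm (BdRPlusTop.of F p (b a))) = _
    rw [RingEquiv.symm_apply_apply, hbP]

end Literature.NumberTheory.PAdicHodge

end
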